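import Literature.Computability.Complexity.UniformDerandomizationHolds
import Literature.Computability.Complexity.ZeroOneLawBPPProofs
import HarnessLib

/-!
# Discharges of named facts of `ZeroOneLawBPP.lean`

`Literature/Computability/Complexity/ZeroOneLawBPPHolds.lean` — proofs-only sibling of
`ZeroOneLawBPP.lean` (no definitions, no named facts). Each theorem below closes a named fact
`X : Prop` of that file as `X_holds : X` by composing an ACCEPTED reduction theorem of the
tree with the ACCEPTED unconditional `_holds` discharges of all of its hypotheses; nothing is
re-proved and no statement is changed. Recorded by the librarian sweep g25 (2026-08-16, pass
5c: facts dischargeable in one line from the tree's own lemmas), so that the facts census,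
`#h21_route_deps` and the cone guardrail see these facts as theorems.

Discharged here:

* `vanMelkebeek2000_zeroOneLaw_holds` := `vanMelkebeek2000_zeroOneLaw_of_IW`
  `impagliazzoWigderson1998_samplable_holds` (`ZeroOneLawBPPProofs.lean`).

## References

* [VanMelkebeek2000] — see `lean/references.bib` and the docstring of the fact in `ZeroOneLawBPP.lean`.
* [VanMelkebeekTCS2000] — see `lean/references.bib` and the docstring of the fact in `ZeroOneLawBPP.lean`.
-/

namespace Literature.Computability.Complexity

/-- **Discharge of the named fact `vanMelkebeek2000_zeroOneLaw`** (`ZeroOneLawBPP.lean`): The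
zero-one law for `BPP` (van Melkebeek 2000, Thm. 6.1.1, verbatim: "BPP has E-measure zero iff
BPP ≠ EXP"; E-measure zero = Lutz's `p`-measure zero, the tree's `PMeasureZero`). Named fact
(D-0014), not proved here: … — obtained as `vanMelkebeek2000_zeroOneLaw_of_IW` applied to the
tree's unconditional discharge `impagliazzoWigderson1998_samplable_holds` of its hypothesis
(reduction in `ZeroOneLawBPPProofs.lean`).
[cite: VanMelkebeek2000, Thm. 6.1.1 (p. 141)]
[cite: VanMelkebeekTCS2000, main theorem] -/
theorem vanMelkebeek2000_zeroOneLaw_holds :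
    vanMelkebeek2000_zeroOneLaw :=
  vanMelkebeek2000_zeroOneLaw_of_IW impagliazzoWigderson1998_samplable_holds

end Literature.Computability.Complexity
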